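import Mathlib
import Summits.NavierStokesRegularity.NavierStokesRegularity.Theorems.EulerZoomLiouvillePowerGaugeEulerLiouvilleSelfSimilarEndpointDecay
import Summits.NavierStokesRegularity.NavierStokesRegularity.Theorems.EulerZoomLiouvillePowerGaugeEulerLiouvilleSelfSimilarEndpointFluxEE
import Summits.NavierStokesRegularity.NavierStokesRegularity.Theorems.EulerZoomLiouvillePowerGaugeEulerLiouvilleSelfSimilarEndpointSobolevIteration
import Summits.NavierStokesRegularity.NavierStokesRegularity.Theorems.EulerZoomLiouvillePowerGaugeEulerLiouvilleSelfSimilarEndpointSobolevGrowth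
import Summits.NavierStokesRegularity.NavierStokesRegularity.Theorems.EulerZoomLiouvillePowerGaugeEulerLiouvilleSelfSimilarEndpointSobolevShell
import HarnessLib

/-!
# Rung C1 of the crux `EulerZoomLiouville.PowerGaugeEulerLiouville` at the endpoint `ρ = 1/2`:
# the GROWTH-FREE energy drain `∫_{L≤|y|<2L} ‖V‖² ≤ C_ε L^{−5/2+ε}` from the weak gradient

Route №10 `EulerZoomLiouville` (NavierStokesRegularity), crux E = stmt-NavierStokesRegularity-19832,
registered open stub `stub_selfSimilarWeakRest`, endpoint `ρ = 1/2`.  Chae–Shvydkoy's Thm 3.1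
(ARMA 209 (2013), §3.1) and its weak-class forms in the tree (`shell_energy_decay_half`,
`EndpointFlux.shell_energy_decay_half_of_flux`) prove the drain `∫_{L≤|y|<2L}‖V‖² ≤ C_ε L^{−5+ε}`
under the POINTWISE sublinear growth `‖V(y)‖ ≤ C_up|y|^{1−δ}`.  Here that hypothesis is replaced by a
WEAK GRADIENT `G` of `V` with `∫_{B_R} |G|²_F ≤ C_G R^{1/2}` (`R ≥ 1`) — which every endpoint member of
Seregin's class has (`∫ |G|²_F |y|^{−1/2} ≤ c/5`, `profileData_of_selfSimilar`):

* `EndpointSobolev.shell_energy_decay_half_of_flux_of_weakGradient` — `V ∈ L² ∩ L³_loc`,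
  `|P|‖V‖ ∈ L¹_loc`, Chae–Shvydkoy's flux inequality (3.2), the Riesz representation of `P` at large
  scales, and the weak-gradient bound ⇒ `∫_{L≤|y|<2L} ‖V‖² ≤ C_ε L^{−5/2+ε}` for all `L ≥ 1`, every
  `ε > 0`.  Mechanism: the scale-invariant Sobolev inequality gives `∫_{B_{32L}}‖V‖⁶ ≤ N⁶ L^{3/2}`,
  two Cauchy–Schwarz steps give `∫_S‖V‖³ ≤ (∫‖V‖⁶)^{1/4} e^{3/4}` and `√(∫_T‖V‖⁴) ≤ (∫‖V‖⁶)^{1/4} e_T^{1/4}`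
  (`…SobolevTools`, `…SobolevGrowth`), the pressure lemma with the mid source in `L⁴` (`…SobolevShell`) and the tree's
  far-field terms give the recursion `f(L) ≤ C₁ L^{−5/8} S(L)^{3/4} + C₂ √S(L) L^{−5/2}`, iterated to its
  least fixed point `min((5/8)/(1/4), 5) = 5/2` (`…SobolevIteration`);
* `EndpointSobolev.shell_energy_decay_half_of_profileEE_of_weakGradient` — the same from the profile
  local energy EQUALITY in test-function form (`EndpointFlux.shell_energy_le_flux_of_profileEE_half`);
* `EndpointSobolev.profile_false_half_of_shellLower_of_profileEE_of_weakGradient` — plus a lower bound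
  `c₀ L^{−5/2+η} ≤ ∫_{L≤|y|<2L}‖V‖²` (`c₀, η > 0`) along radii beyond every bound ⇒ contradiction.

WHAT THIS IS NOT: not NS, not E, not the stub — the profile-level core of one endpoint weak stratum;
the drain rate `5/2` (not `5`) is what the class's `H¹` information buys without a growth bound.
[cite: ChaeShvydkoy2013, §3.1 proof of Thm. 3.1; BronziShvydkoy2015, Remark 1.5]
-/

noncomputable section

-- flat `Theorems/<Route><Decl>…` files of one crux share the namespace of the crux (tree convention)
set_option linter.dupNamespace false

open MeasureTheory Set Filter Topology Metric Function Finset TopologicalSpace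
open scoped ENNReal NNReal InnerProductSpace RealInnerProductSpace

namespace Summit.NavierStokesRegularity.NavierStokesRegularity.Theorems.PowerGaugeEulerLiouville

open Literature.Analysis Literature.Analysis.FluidPDE Literature.Analysis.FunctionSpaces

namespace EndpointSobolev

section Decay

variable {V : EuclideanSpace ℝ (Fin 3) → EuclideanSpace ℝ (Fin 3)} {P : EuclideanSpace ℝ (Fin 3) → ℝ}

/-- **Growth-free energy drain of endpoint profiles, from the flux inequality and a weak gradient.**
Let `(V, P)` be a profile pair with `V ∈ L²(ℝ³) ∩ L³_loc`, `|P||V| ∈ L¹_loc`, Chae–Shvydkoy's shell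
flux inequality (3.2), the Riesz representation `P = Π[V·1_{B_R}] + ∫_{|z| ≥ R} K(·−z)(V z) dz` a.e. on
`|y| < R/2` for all `R ≥ R₁`, and a WEAK GRADIENT `G` of `V` on `ℝ³` with
`∫_{B_R} |G|²_F ≤ C_G R^{1/2}` for `R ≥ 1`.  Then for every `ε > 0` there is `C` with
`∫_{L ≤ |y| < 2L} ‖V‖² ≤ C L^{−5/2+ε}` for all `L ≥ 1` — NO pointwise growth hypothesis.
[cite: ChaeShvydkoy2013, §3.1 proof of Thm. 3.1; BronziShvydkoy2015, Remark 1.5] -/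
theorem shell_energy_decay_half_of_flux_of_weakGradient
    (hVm : AEStronglyMeasurable V volume) (hV2 : Integrable (fun z => ‖V z‖ ^ 2) volume)
    (hV3 : LocallyIntegrable (fun y => ‖V y‖ ^ 3) volume)
    (hPV : LocallyIntegrable (fun y => |P y| * ‖V y‖) volume)
    (hflux : ∃ K : ℝ, 0 ≤ K ∧ ∀ L : ℝ, 0 < L →
      ∫ y in {y | L ≤ ‖y‖ ∧ ‖y‖ < 2 * L}, ‖V y‖ ^ 2 ≤
        K / L * ∫ y in {y | L / 4 ≤ ‖y‖ ∧ ‖y‖ ≤ 8 * L}, (‖V y‖ ^ 3 + 2 * (|P y| * ‖V y‖)))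
    {R₁ : ℝ}
    (hP : ∀ R : ℝ, R₁ ≤ R → ∀ᵐ y ∂volume, ‖y‖ < R / 2 →
      P y = rieszPressure ((ball (0 : EuclideanSpace ℝ (Fin 3)) R).indicator V) y +
        ∫ z in {z | R ≤ ‖z‖}, pressureKernel (y - z) (V z))
    {G : EuclideanSpace ℝ (Fin 3) → EuclideanSpace ℝ (Fin 3) →L[ℝ] EuclideanSpace ℝ (Fin 3)}
    (hW : HasWeakFDerivOn (⊤ : Opens (EuclideanSpace ℝ (Fin 3))) volume V G)
    (hGm : AEStronglyMeasurable G volume) {C_G : ℝ} (hCG : 0 ≤ C_G)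
    (hGB : ∀ R : ℝ, 1 ≤ R →
      (∫⁻ y in ball (0 : EuclideanSpace ℝ (Fin 3)) R, ENNReal.ofReal (frobeniusNormSq (G y))) ≤
        ENNReal.ofReal (C_G * R ^ (1 / 2 : ℝ)))
    {ε : ℝ} (hε : 0 < ε) :
    ∃ C : ℝ, ∀ L : ℝ, 1 ≤ L →
      ∫ y in {y | L ≤ ‖y‖ ∧ ‖y‖ < 2 * L}, ‖V y‖ ^ 2 ≤ C * L ^ (-(5 / 2 : ℝ) + ε) := by
  -- adapted from `EndpointFlux.shell_energy_decay_half_of_flux` (…SelfSimilarEndpointDecayFlux): constants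
  obtain ⟨K, hK0, hK⟩ := hflux
  obtain ⟨C_S, hCS⟩ := exists_eLpNorm_rieszPressure_two_le
  obtain ⟨N₀, hN₀0, hsix⟩ := exists_integral_norm_pow_six_ball_le hW hVm hGm hV2 hCG hGB
  set E₂ : ℝ := ∫ z, ‖V z‖ ^ 2 with hE₂
  have hE₂0 : 0 ≤ E₂ := integral_nonneg fun z => by positivity
  set v₁ : ℝ := volume.real (ball (0 : EuclideanSpace ℝ (Fin 3)) 1) with hv₁
  have hv₁0 : 0 ≤ v₁ := measureReal_nonneg
  -- the Sobolev constant at source scale `32L`: `∫_{B_{32L}} ‖V‖⁶ ≤ N6 · L^{3/2}` for `L ≥ 1`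
  set N6 : ℝ := N₀ * (32 : ℝ) ^ (3 / 2 : ℝ) with hN6
  have hN60 : 0 ≤ N6 := by positivity
  set A : ℝ := N6 ^ (1 / 4 : ℝ) with hA
  have hA0 : 0 ≤ A := Real.rpow_nonneg hN60 _
  -- the shell energies and the window sum
  set f : ℝ → ℝ := fun L => ∫ y in {y | L ≤ ‖y‖ ∧ ‖y‖ < 2 * L}, ‖V y‖ ^ 2 with hf
  set S : ℝ → ℝ := fun L => ∑ k ∈ range (2 * 5 + 1), f (2 ^ k * L / 2 ^ 5) with hS
  have hf0 : ∀ L, 0 < L → 0 ≤ f L := fun L _ =>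
    setIntegral_nonneg ((measurableSet_le measurable_const measurable_norm).inter
      (measurableSet_lt measurable_norm measurable_const)) fun y _ => by positivity
  have hfB : ∀ L, 0 < L → f L ≤ E₂ := fun L _ =>
    setIntegral_le_integral hV2 (Eventually.of_forall fun y => by positivity)
  -- the recursion constants
  set C₁ : ℝ := K * A * (1 + 2 * C_S) with hC₁
  set C₂ : ℝ := K * (4 * E₂ * (512 * Real.sqrt (512 * v₁) / (2 * Real.pi))) with hC₂
  have hC₁0 : 0 ≤ C₁ := by positivity
  have hC₂0 : 0 ≤ C₂ := by positivity
  set L₁ : ℝ := max (R₁ / 32) 1 with hL₁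
  have hL₁1 : 1 ≤ L₁ := le_max_right _ _
  have hL₁0 : 0 < L₁ := one_pos.trans_le hL₁1
  -- the recursion
  have hrec : ∀ L, L₁ ≤ L → f L ≤ C₁ * L ^ (-(5 / 8 : ℝ)) * S L ^ (3 / 4 : ℝ) +
      C₂ * Real.sqrt (S L) * L ^ (-(5 / 2 : ℝ)) := by
    intro L hLL
    have hL1 : 1 ≤ L := hL₁1.trans hLL
    have hL : 0 < L := one_pos.trans_le hL1
    have hR₁L : R₁ ≤ 32 * L := by
      have : R₁ / 32 ≤ L := (le_max_left _ _).trans hLL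
      linarith
    -- the sets and their energies
    set Sh : Set (EuclideanSpace ℝ (Fin 3)) := {y | L / 4 ≤ ‖y‖ ∧ ‖y‖ ≤ 8 * L} with hShdef
    set T : Set (EuclideanSpace ℝ (Fin 3)) := {y | L / 8 ≤ ‖y‖ ∧ ‖y‖ < 32 * L} with hTdef
    set B : Set (EuclideanSpace ℝ (Fin 3)) := ball 0 (32 * L) with hBdef
    set eS : ℝ := ∫ y in Sh, ‖V y‖ ^ 2 with heS
    set eT : ℝ := ∫ y in T, ‖V y‖ ^ 2 with heT
    have hSm : MeasurableSet Sh := (measurableSet_le measurable_const measurable_norm).inter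
      (measurableSet_le measurable_norm measurable_const)
    have hTm : MeasurableSet T := (measurableSet_le measurable_const measurable_norm).inter
      (measurableSet_lt measurable_norm measurable_const)
    have hShB : Sh ⊆ B := fun y hy => by
      rw [hBdef, mem_ball, dist_zero_right]; linarith [hy.2]
    have hTB : T ⊆ B := fun y hy => by
      rw [hBdef, mem_ball, dist_zero_right]; exact hy.2
    have heS0 : 0 ≤ eS := setIntegral_nonneg hSm fun y _ => by positivity
    have heST : eS ≤ eT :=
      setIntegral_mono_set hV2.integrableOn (Eventually.of_forall fun y => by positivity)
        (Eventually.of_forall fun y hy => ⟨by linarith [hy.1], by linarith [hy.2]⟩)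
    have heTS : eT ≤ S L := by
      have := windowSum_ge_setIntegral hV2 hL
      rw [hS]; exact this
    have heT0 : 0 ≤ eT := heS0.trans heST
    have hSL0 : 0 ≤ S L := heT0.trans heTS
    have heSS : eS ≤ S L := heST.trans heTS
    -- Sobolev on `B_{32L}`: `∫_B ‖V‖⁶ ≤ N6 L^{3/2}`
    have h32L : (1 : ℝ) ≤ 32 * L := by linarith
    obtain ⟨hI6B, hq⟩ := hsix (32 * L) h32L
    set q : ℝ := ∫ y in B, ‖V y‖ ^ 6 with hqdef
    have hq0 : 0 ≤ q := setIntegral_nonneg measurableSet_ball fun y _ => by positivity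
    have hqN : q ≤ N6 * L ^ (3 / 2 : ℝ) := by
      refine hq.trans (le_of_eq ?_)
      rw [hN6, Real.mul_rpow (by norm_num) hL.le]; ring
    have hq4 : q ^ (1 / 4 : ℝ) ≤ A * L ^ (3 / 8 : ℝ) := by
      rw [hA, ← rpow_quarter_mul hN60 hL.le]
      exact Real.rpow_le_rpow hq0 hqN (by norm_num)
    -- `‖V‖⁶ ∈ L¹` on `Sh` and `T`, with integrals `≤ q`
    have hI6S : IntegrableOn (fun y => ‖V y‖ ^ 6) Sh volume := hI6B.mono_set hShB
    have hI6T : IntegrableOn (fun y => ‖V y‖ ^ 6) T volume := hI6B.mono_set hTB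
    have h6S : ∫ y in Sh, ‖V y‖ ^ 6 ≤ q :=
      setIntegral_mono_set hI6B (Eventually.of_forall fun y => by positivity) hShB.eventuallyLE
    have h6T : ∫ y in T, ‖V y‖ ^ 6 ≤ q :=
      setIntegral_mono_set hI6B (Eventually.of_forall fun y => by positivity) hTB.eventuallyLE
    have h6S0 : 0 ≤ ∫ y in Sh, ‖V y‖ ^ 6 := setIntegral_nonneg hSm fun y _ => by positivity
    have h6T0 : 0 ≤ ∫ y in T, ‖V y‖ ^ 6 := setIntegral_nonneg hTm fun y _ => by positivity
    -- flux lemma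
    have h1 := hK L hL
    -- cubic on the shell: `∫_S ‖V‖³ ≤ q^{1/4} eS^{3/4} ≤ A L^{3/8} (S L)^{3/4}`
    have hcub : ∫ y in Sh, ‖V y‖ ^ 3 ≤ A * L ^ (3 / 8 : ℝ) * S L ^ (3 / 4 : ℝ) := by
      have h := setIntegral_norm_pow_three_le hVm hV2.integrableOn hI6S
      calc ∫ y in Sh, ‖V y‖ ^ 3 ≤ (∫ y in Sh, ‖V y‖ ^ 6) ^ (1 / 4 : ℝ) * eS ^ (3 / 4 : ℝ) := h
        _ ≤ q ^ (1 / 4 : ℝ) * S L ^ (3 / 4 : ℝ) := by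
            gcongr
        _ ≤ A * L ^ (3 / 8 : ℝ) * S L ^ (3 / 4 : ℝ) :=
            mul_le_mul_of_nonneg_right hq4 (Real.rpow_nonneg hSL0 _)
    -- pressure on the shell
    have h4T : IntegrableOn (fun y => ‖V y‖ ^ 4) T volume :=
      integrableOn_norm_pow_four hVm hV2.integrableOn hI6T
    have hmid4 : MemLp (T.indicator V) 4 volume := memLp_indicator_four_of_integrableOn hVm hTm h4T
    have hP32 : ∀ᵐ y ∂volume, ‖y‖ < 16 * L →
        P y = rieszPressure ((ball (0 : EuclideanSpace ℝ (Fin 3)) (32 * L)).indicator V) y +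
          ∫ z in {z | 32 * L ≤ ‖z‖}, pressureKernel (y - z) (V z) := by
      filter_upwards [hP (32 * L) hR₁L] with y hy hy16
      exact hy (by linarith)
    have hpre := shell_pressure_le_of_memLp_four hCS hVm hV2 hV3 hPV hL hmid4 hP32
    -- `√(∫_T ‖V‖⁴) √eS ≤ q^{1/4} eT^{1/4} eS^{1/2} ≤ A L^{3/8} (S L)^{3/4}`
    have h4sqrt : Real.sqrt (∫ y in T, ‖V y‖ ^ 4) * Real.sqrt eS ≤
        A * L ^ (3 / 8 : ℝ) * S L ^ (3 / 4 : ℝ) := by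
      have h4le := setIntegral_norm_pow_four_le hVm hV2.integrableOn hI6T
      have step1 : Real.sqrt (∫ y in T, ‖V y‖ ^ 4) ≤ Real.sqrt (Real.sqrt q * Real.sqrt (S L)) := by
        refine Real.sqrt_le_sqrt (h4le.trans ?_)
        gcongr
      have step2 : Real.sqrt (Real.sqrt q * Real.sqrt (S L)) * Real.sqrt (S L) =
          q ^ (1 / 4 : ℝ) * S L ^ (3 / 4 : ℝ) := by
        rw [Real.sqrt_eq_rpow, Real.sqrt_eq_rpow, Real.sqrt_eq_rpow,
          Real.mul_rpow (Real.rpow_nonneg hq0 _) (Real.rpow_nonneg hSL0 _),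
          ← Real.rpow_mul hq0, ← Real.rpow_mul hSL0, mul_assoc, ← Real.rpow_add' hSL0 (by norm_num)]
        norm_num
      calc Real.sqrt (∫ y in T, ‖V y‖ ^ 4) * Real.sqrt eS
          ≤ Real.sqrt (Real.sqrt q * Real.sqrt (S L)) * Real.sqrt (S L) :=
            mul_le_mul step1 (Real.sqrt_le_sqrt heSS) (Real.sqrt_nonneg _) (Real.sqrt_nonneg _)
        _ = q ^ (1 / 4 : ℝ) * S L ^ (3 / 4 : ℝ) := step2
        _ ≤ A * L ^ (3 / 8 : ℝ) * S L ^ (3 / 4 : ℝ) :=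
            mul_le_mul_of_nonneg_right hq4 (Real.rpow_nonneg hSL0 _)
    -- volume of `B̄_{8L}`
    have hvol : volume.real (closedBall (0 : EuclideanSpace ℝ (Fin 3)) (8 * L)) = (8 * L) ^ 3 * v₁ := by
      rw [Measure.addHaar_real_closedBall _ _ (by positivity), finrank_euclideanSpace_fin]
    rw [hvol] at hpre
    -- combine: `f L ≤ (K/L) (cubic + 2 pressure)`
    have hN' : (∫ z, ‖V z‖ ^ 2) / (2 * Real.pi * (L / 8) ^ 3) = E₂ * (1 / (2 * Real.pi * (L / 8) ^ 3)) := by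
      rw [hE₂]; ring
    have hstep : f L ≤ K / L * (A * L ^ (3 / 8 : ℝ) * S L ^ (3 / 4 : ℝ) +
        2 * (C_S * (A * L ^ (3 / 8 : ℝ) * S L ^ (3 / 4 : ℝ)) +
          2 * (E₂ * (1 / (2 * Real.pi * (L / 8) ^ 3))) * Real.sqrt ((8 * L) ^ 3 * v₁) *
            Real.sqrt eS)) := by
      refine h1.trans (mul_le_mul_of_nonneg_left ?_ (by positivity))
      rw [integral_add ?_ ?_]
      · rw [integral_const_mul, ← hN']
        refine add_le_add hcub (mul_le_mul_of_nonneg_left (hpre.trans ?_) (by norm_num))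
        have : (C_S : ℝ) * Real.sqrt (∫ y in T, ‖V y‖ ^ 4) * Real.sqrt eS ≤
            C_S * (A * L ^ (3 / 8 : ℝ) * S L ^ (3 / 4 : ℝ)) := by
          rw [mul_assoc]
          exact mul_le_mul_of_nonneg_left h4sqrt C_S.coe_nonneg
        linarith
      · exact (hV3.integrableOn_isCompact (isCompact_closedBall 0 (8 * L))).mono_set
          fun y hy => by rw [mem_closedBall, dist_zero_right]; exact hy.2
      · exact ((hPV.integrableOn_isCompact (isCompact_closedBall 0 (8 * L))).mono_set
          fun y hy => by rw [mem_closedBall, dist_zero_right]; exact hy.2).const_mul 2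
    -- exponent bookkeeping
    have hAB : K / L * (A * L ^ (3 / 8 : ℝ) * S L ^ (3 / 4 : ℝ) +
        2 * (C_S * (A * L ^ (3 / 8 : ℝ) * S L ^ (3 / 4 : ℝ)))) =
        C₁ * L ^ (-(5 / 8 : ℝ)) * S L ^ (3 / 4 : ℝ) := by
      have := rpow_three_eighths_div hL
      calc K / L * (A * L ^ (3 / 8 : ℝ) * S L ^ (3 / 4 : ℝ) +
            2 * (C_S * (A * L ^ (3 / 8 : ℝ) * S L ^ (3 / 4 : ℝ))))
          = K * A * (1 + 2 * C_S) * (L ^ (3 / 8 : ℝ) / L) * S L ^ (3 / 4 : ℝ) := by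
            field_simp
        _ = C₁ * L ^ (-(5 / 8 : ℝ)) * S L ^ (3 / 4 : ℝ) := by rw [this, hC₁]
    have hC : K / L * (2 * (2 * (E₂ * (1 / (2 * Real.pi * (L / 8) ^ 3))) *
        Real.sqrt ((8 * L) ^ 3 * v₁) * Real.sqrt eS)) = C₂ * Real.sqrt eS * L ^ (-(5 / 2 : ℝ)) := by
      have := farField_scaling hL hv₁0
      calc K / L * (2 * (2 * (E₂ * (1 / (2 * Real.pi * (L / 8) ^ 3))) *
            Real.sqrt ((8 * L) ^ 3 * v₁) * Real.sqrt eS))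
          = K * (4 * E₂ * (1 / (2 * Real.pi * (L / 8) ^ 3) * Real.sqrt ((8 * L) ^ 3 * v₁) / L)) *
              Real.sqrt eS := by field_simp; ring
        _ = C₂ * Real.sqrt eS * L ^ (-(5 / 2 : ℝ)) := by rw [this, hC₂]; ring
    have hL52 : 0 < L ^ (-(5 / 2 : ℝ)) := Real.rpow_pos_of_pos hL _
    calc f L ≤ K / L * (A * L ^ (3 / 8 : ℝ) * S L ^ (3 / 4 : ℝ) +
          2 * (C_S * (A * L ^ (3 / 8 : ℝ) * S L ^ (3 / 4 : ℝ)))) +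
          K / L * (2 * (2 * (E₂ * (1 / (2 * Real.pi * (L / 8) ^ 3))) *
            Real.sqrt ((8 * L) ^ 3 * v₁) * Real.sqrt eS)) := by
          refine hstep.trans (le_of_eq ?_); ring
      _ = C₁ * L ^ (-(5 / 8 : ℝ)) * S L ^ (3 / 4 : ℝ) + C₂ * Real.sqrt eS * L ^ (-(5 / 2 : ℝ)) := by
          rw [hAB, hC]
      _ ≤ C₁ * L ^ (-(5 / 8 : ℝ)) * S L ^ (3 / 4 : ℝ) + C₂ * Real.sqrt (S L) * L ^ (-(5 / 2 : ℝ)) := by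
          gcongr
  -- iterate
  obtain ⟨C, hC⟩ := shell_decay_of_recursion_rpow (θ := 5 / 8) (q := 3 / 4) (κ := 5 / 2) (m := 5)
    hf0 hfB (by norm_num) (by norm_num) (by norm_num) (by norm_num) hC₁0 hC₂0 hL₁0
    (fun L => rfl) hrec hε
  refine ⟨C, fun L hL => ?_⟩
  have := hC L hL
  norm_num at this ⊢
  exact this

/-- **Growth-free energy drain from the profile local energy EQUALITY** (test-function form at
`γ = 2/5`): `EndpointFlux.shell_energy_le_flux_of_profileEE_half` +
`shell_energy_decay_half_of_flux_of_weakGradient`.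
[cite: ChaeShvydkoy2013, §3.1 proof of Thm. 3.1] -/
theorem shell_energy_decay_half_of_profileEE_of_weakGradient
    (hVm : AEStronglyMeasurable V volume) (hV2 : Integrable (fun z => ‖V z‖ ^ 2) volume)
    (hV3 : LocallyIntegrable (fun y => ‖V y‖ ^ 3) volume)
    (hPV : LocallyIntegrable (fun y => |P y| * ‖V y‖) volume)
    {γ : ℝ} (hγ : γ = 2 / 5)
    (hEE : ∀ σ : EuclideanSpace ℝ (Fin 3) → ℝ,
      IsTestFunctionOn (⊤ : TopologicalSpace.Opens (EuclideanSpace ℝ (Fin 3))) σ →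
        (2 - 5 * γ) * ∫ x, σ x * ‖V x‖ ^ 2 =
          (∫ x, (‖V x‖ ^ 2 + 2 * P x) * ⟪V x, gradient σ x⟫) +
            γ * ∫ x, ‖V x‖ ^ 2 * ⟪x, gradient σ x⟫)
    {R₁ : ℝ}
    (hP : ∀ R : ℝ, R₁ ≤ R → ∀ᵐ y ∂volume, ‖y‖ < R / 2 →
      P y = rieszPressure ((ball (0 : EuclideanSpace ℝ (Fin 3)) R).indicator V) y +
        ∫ z in {z | R ≤ ‖z‖}, pressureKernel (y - z) (V z))
    {G : EuclideanSpace ℝ (Fin 3) → EuclideanSpace ℝ (Fin 3) →L[ℝ] EuclideanSpace ℝ (Fin 3)}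
    (hW : HasWeakFDerivOn (⊤ : Opens (EuclideanSpace ℝ (Fin 3))) volume V G)
    (hGm : AEStronglyMeasurable G volume) {C_G : ℝ} (hCG : 0 ≤ C_G)
    (hGB : ∀ R : ℝ, 1 ≤ R →
      (∫⁻ y in ball (0 : EuclideanSpace ℝ (Fin 3)) R, ENNReal.ofReal (frobeniusNormSq (G y))) ≤
        ENNReal.ofReal (C_G * R ^ (1 / 2 : ℝ)))
    {ε : ℝ} (hε : 0 < ε) :
    ∃ C : ℝ, ∀ L : ℝ, 1 ≤ L →
      ∫ y in {y | L ≤ ‖y‖ ∧ ‖y‖ < 2 * L}, ‖V y‖ ^ 2 ≤ C * L ^ (-(5 / 2 : ℝ) + ε) :=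
  shell_energy_decay_half_of_flux_of_weakGradient hVm hV2 hV3 hPV
    (EndpointFlux.shell_energy_le_flux_of_profileEE_half hγ hV2.locallyIntegrable hV3 hPV hEE) hP
    hW hGm hCG hGB hε

/-- **Profile-level endpoint Liouville from the energy EQUALITY, a weak gradient and a shell lower
bound above the growth-free drain rate**: under the hypotheses of
`shell_energy_decay_half_of_profileEE_of_weakGradient`, a lower bound
`c₀ L^{−5/2+η} ≤ ∫_{L≤|y|<2L}‖V‖²` (`c₀, η > 0`) along radii beyond every bound is contradictory.
[cite: ChaeShvydkoy2013, §3.1 Thm. 3.1] -/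
theorem profile_false_half_of_shellLower_of_profileEE_of_weakGradient
    (hVm : AEStronglyMeasurable V volume) (hV2 : Integrable (fun z => ‖V z‖ ^ 2) volume)
    (hV3 : LocallyIntegrable (fun y => ‖V y‖ ^ 3) volume)
    (hPV : LocallyIntegrable (fun y => |P y| * ‖V y‖) volume)
    {γ : ℝ} (hγ : γ = 2 / 5)
    (hEE : ∀ σ : EuclideanSpace ℝ (Fin 3) → ℝ,
      IsTestFunctionOn (⊤ : TopologicalSpace.Opens (EuclideanSpace ℝ (Fin 3))) σ →
        (2 - 5 * γ) * ∫ x, σ x * ‖V x‖ ^ 2 =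
          (∫ x, (‖V x‖ ^ 2 + 2 * P x) * ⟪V x, gradient σ x⟫) +
            γ * ∫ x, ‖V x‖ ^ 2 * ⟪x, gradient σ x⟫)
    {R₁ : ℝ}
    (hP : ∀ R : ℝ, R₁ ≤ R → ∀ᵐ y ∂volume, ‖y‖ < R / 2 →
      P y = rieszPressure ((ball (0 : EuclideanSpace ℝ (Fin 3)) R).indicator V) y +
        ∫ z in {z | R ≤ ‖z‖}, pressureKernel (y - z) (V z))
    {G : EuclideanSpace ℝ (Fin 3) → EuclideanSpace ℝ (Fin 3) →L[ℝ] EuclideanSpace ℝ (Fin 3)}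
    (hW : HasWeakFDerivOn (⊤ : Opens (EuclideanSpace ℝ (Fin 3))) volume V G)
    (hGm : AEStronglyMeasurable G volume) {C_G : ℝ} (hCG : 0 ≤ C_G)
    (hGB : ∀ R : ℝ, 1 ≤ R →
      (∫⁻ y in ball (0 : EuclideanSpace ℝ (Fin 3)) R, ENNReal.ofReal (frobeniusNormSq (G y))) ≤
        ENNReal.ofReal (C_G * R ^ (1 / 2 : ℝ)))
    {c₀ η : ℝ} (hc₀ : 0 < c₀) (hη : 0 < η)
    (hlow : ∀ L₁ : ℝ, ∃ L : ℝ, L₁ ≤ L ∧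
      c₀ * L ^ (-(5 / 2 : ℝ) + η) ≤
        ∫ y in {y : EuclideanSpace ℝ (Fin 3) | L ≤ ‖y‖ ∧ ‖y‖ < 2 * L}, ‖V y‖ ^ 2) : False := by
  -- adapted from `EndpointFlux.profile_false_half_of_shellLower_of_profileEE` (same endgame, rate 5/2)
  obtain ⟨C, hC⟩ := shell_energy_decay_half_of_profileEE_of_weakGradient hVm hV2 hV3 hPV hγ hEE hP
    hW hGm hCG hGB (half_pos hη)
  have hkey : ∀ L : ℝ, 1 ≤ L →
      c₀ * L ^ (-(5 / 2 : ℝ) + η) ≤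
        ∫ y in {y : EuclideanSpace ℝ (Fin 3) | L ≤ ‖y‖ ∧ ‖y‖ < 2 * L}, ‖V y‖ ^ 2 →
      c₀ * L ^ (η / 2) ≤ C := by
    intro L hL1 hL
    have hL0 : 0 < L := one_pos.trans_le hL1
    have h1 : c₀ * L ^ (-(5 / 2 : ℝ) + η) ≤ C * L ^ (-(5 / 2 : ℝ) + η / 2) := hL.trans (hC L hL1)
    have h2 := mul_le_mul_of_nonneg_right h1 (Real.rpow_pos_of_pos hL0 (5 / 2 - η / 2)).le
    have e1 : c₀ * L ^ (-(5 / 2 : ℝ) + η) * L ^ (5 / 2 - η / 2) = c₀ * L ^ (η / 2) := by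
      rw [mul_assoc, ← Real.rpow_add hL0]; ring_nf
    have e2 : C * L ^ (-(5 / 2 : ℝ) + η / 2) * L ^ (5 / 2 - η / 2) = C := by
      rw [mul_assoc, ← Real.rpow_add hL0, show -(5 / 2 : ℝ) + η / 2 + (5 / 2 - η / 2) = 0 by ring,
        Real.rpow_zero, mul_one]
    rwa [e1, e2] at h2
  have hev : ∀ᶠ L : ℝ in atTop, C / c₀ < L ^ (η / 2) :=
    (tendsto_rpow_atTop (half_pos hη)).eventually_gt_atTop (C / c₀)
  obtain ⟨L₁, hL₁⟩ := (hev.and (eventually_ge_atTop (1 : ℝ))).exists_forall_of_atTop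
  obtain ⟨L, hLL₁, hL⟩ := hlow L₁
  have h := hkey L (hL₁ L hLL₁).2 hL
  have h' := (hL₁ L hLL₁).1
  rw [div_lt_iff₀ hc₀] at h'
  linarith [mul_comm c₀ (L ^ (η / 2))]

end Decay

end EndpointSobolev

end Summit.NavierStokesRegularity.NavierStokesRegularity.Theorems.PowerGaugeEulerLiouville
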